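import Summits.Ventures.CertifiedArithmetic.Statement
import Summits.Ventures.CertifiedArithmetic.LowPrec.DoubleRoundingAccumulate
import Summits.Ventures.CertifiedArithmetic.LowPrec.KahanRange
import Summits.Ventures.CertifiedArithmetic.LowPrec.ExactDot
import Summits.Ventures.CertifiedArithmetic.LowPrec.DirectedEFT
import Summits.Ventures.CertifiedArithmetic.LowPrec.AccumulateLangeRump
import Summits.Ventures.CertifiedArithmetic.LowPrec.AccumulateHeight

/-!
# Lean-seat rung statements beyond `Statement.lean` (R1/R2: conversions, pipelines, Kahan, Lemma Z)

HONEST FRAMING (venture CertifiedArithmetic / cell `pub-lowprec`): certified error envelopes and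
provably optimal rounding/accumulation schemes for low-precision formats under stated cost models;
every table by two implementations; no hardware or vendor claims.

`Summits/Ventures/CertifiedArithmetic/Statement.lean` (venture statement verbatim + rung Props
R1–R4) is at the gate's 400-line limit, so the theorem-shaped rung targets landed by the lean seat
(generation 3) are stated HERE, in the same namespace and style — a `Prop` quantifying over all data
of every format (or of named format pairs), docstring naming the landed proof — each followed by
its `_holds` theorem. Nothing here is a `True`/vacuous definition.
-/

namespace Summit.Ventures.CertifiedArithmetic

open Finset
open Literature.ComputerArithmetic.FloatingPoint
open Literature.ComputerArithmetic.FloatingPoint.MiniFloat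
open Literature.ComputerArithmetic.FloatingPoint.Format
open Literature.ComputerArithmetic.JeannerodRump2018

/-! ### R1 — conversions -/

/-- R1 (EMBEDDING / EXACT WIDENING): under `m_φ ≤ m_ψ`, `qexp ψ ≤ qexp φ`, `maxRat φ ≤ maxRat ψ`
every value of `φ` is a value of `ψ` and the widening conversion `roundNE ψ` is exact; and the
datum-level operations commute across operand formats (`fadd ψ a b = fadd ψ b a`, `fmul` likewise).
PROVED: `MiniFloat.exists_toRat_eq_of_le`, `MiniFloat.toRat_roundNE_eq_of_le`, `MiniFloat.fadd_comm`,
`MiniFloat.fmul_comm` (Conversion.lean). -/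
def R1_Conversions (φ ψ : Format) : Prop :=
  (φ.manBits ≤ ψ.manBits → ψ.qexp ≤ φ.qexp → φ.maxRat ≤ ψ.maxRat →
    ∀ x : MiniFloat φ, (∃ z : MiniFloat ψ, z.toRat = x.toRat) ∧ (roundNE ψ x.toRat).toRat = x.toRat) ∧
  (∀ (ρ : Format) (a : MiniFloat φ) (b : MiniFloat ψ), fadd ρ a b = fadd ρ b a ∧ fmul ρ a b = fmul ρ b a)

/-- R1 conversions: PROVED for every pair of formats. -/
theorem R1_Conversions_holds (φ ψ : Format) : R1_Conversions φ ψ :=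
  ⟨fun hm hq hmax x => ⟨exists_toRat_eq_of_le hm hq hmax x, toRat_roundNE_eq_of_le hm hq hmax x⟩,
    fun ρ a b => ⟨fadd_comm ρ a b, fmul_comm ρ a b⟩⟩

/-! ### R2 — accumulation pipelines and schemes -/

/-- R2 (DOUBLE ROUNDING OF SUMS IS INNOCUOUS, Figueroa's condition): for formats with
`2·m_φ + 2 ≤ m_ψ`, `bias_φ ≤ bias_ψ`, `maxRat φ ≤ maxRat ψ`: adding two `φ`-data in `ψ` and
converting to `φ` equals correctly rounded `φ`-addition for ALL data (saturating RNE), and hence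
every evaluation tree with node operation `fl_φ ∘ fl_ψ` ("`ψ` adder, `φ` storage") evaluates to the
same value as with `fl_φ`. PROVED: `MiniFloat.toRat_roundNE_roundNE_add` (DoubleRounding.lean),
`MiniFloat.eval_wide_then_narrow_eq` (DoubleRoundingAccumulate.lean); format-pair verdicts incl.
kernel counterexamples where the hypotheses fail: DoubleRoundingVerdicts(P3109).lean. -/
def R2_WideAddNarrow (φ ψ : Format) : Prop :=
  2 * φ.manBits + 2 ≤ ψ.manBits → φ.bias ≤ ψ.bias → φ.maxRat ≤ ψ.maxRat →
    (∀ a b : MiniFloat φ,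
      (roundNE φ (roundNE ψ (a.toRat + b.toRat)).toRat).toRat = (roundNE φ (a.toRat + b.toRat)).toRat) ∧
    (∀ t : SumTree, (∀ x ∈ t.leaves, ∃ y : MiniFloat φ, y.toRat = x) →
      SumTree.eval (fun z => flα φ (flα ψ z)) t = SumTree.eval (flα φ) t)

/-- R2 wide-add-narrow: PROVED for every pair of formats (hypotheses as stated). -/
theorem R2_WideAddNarrow_holds (φ ψ : Format) : R2_WideAddNarrow φ ψ :=
  fun hm hb hmax => ⟨toRat_roundNE_roundNE_add hm hb hmax, eval_wide_then_narrow_eq hm hb hmax⟩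

/-- The named accumulator pipelines: bfloat16 or binary16 storage with a binary32 adder, `E4M3` or
`E5M2` storage with a binary16 adder satisfy the hypotheses of `R2_WideAddNarrow`. [folklore] -/
theorem R2_WideAddNarrow_pipelines :
    (∀ t : SumTree, (∀ x ∈ t.leaves, ∃ y : MiniFloat BFloat16, y.toRat = x) →
      SumTree.eval (fun z => flα BFloat16 (flα Binary32 z)) t = SumTree.eval (flα BFloat16) t) ∧
    (∀ t : SumTree, (∀ x ∈ t.leaves, ∃ y : MiniFloat Binary16, y.toRat = x) →
      SumTree.eval (fun z => flα Binary16 (flα Binary32 z)) t = SumTree.eval (flα Binary16) t) ∧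
    (∀ t : SumTree, (∀ x ∈ t.leaves, ∃ y : MiniFloat E4M3, y.toRat = x) →
      SumTree.eval (fun z => flα E4M3 (flα Binary16 z)) t = SumTree.eval (flα E4M3) t) ∧
    (∀ t : SumTree, (∀ x ∈ t.leaves, ∃ y : MiniFloat E5M2, y.toRat = x) →
      SumTree.eval (fun z => flα E5M2 (flα Binary16 z)) t = SumTree.eval (flα E5M2) t) :=
  ⟨eval_Binary32_then_BFloat16_eq, eval_Binary32_then_Binary16_eq, eval_Binary16_then_E4M3_eq,
    eval_Binary16_then_E5M2_eq⟩

/-- R2 (KAHAN'S COMPENSATED SUMMATION, EXPLICIT ENVELOPE, data-only hypotheses): for a format `α`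
with `emaxCode ≥ 2` and `u ≤ 1/16`, summands `x₀ … xₙ ∈ F_α` with `n·u ≤ 1/4` and
`10·Σ|xᵢ| ≤ maxRat`: the returned `ŝₙ` of `kahan` (gemm's algorithm, every op `roundNE α`) obeys
`|ŝₙ - Σxᵢ| ≤ u|ŝₙ| + (2u + 6u² + 12nu²)·Σ|xᵢ|`, and the compensated pair
`|ŝₙ + cₙ - Σxᵢ| ≤ (2u + 6u² + 12nu²)·Σ|xᵢ|` — no saturation occurs. PROVED:
`MiniFloat.abs_kahan_sub_sum_le_of_sum_le`, `MiniFloat.abs_kahan_pair_sub_sum_le_of_sum_le`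
(KahanRange.lean; the per-step form with explicit range hypotheses and a free bound `T` is
`MiniFloat.abs_kahan_sub_sum_le`, KahanEnvelope.lean). -/
def R2_KahanEnvelope (α : Format) : Prop :=
  2 ≤ α.emaxCode → α.unitRoundoff ≤ 1 / 16 →
    ∀ (x : ℕ → ℚ) (n : ℕ), (n : ℚ) * α.unitRoundoff ≤ 1 / 4 →
      (∀ i ≤ n, ∃ y : MiniFloat α, y.toRat = x i) →
      10 * ∑ i ∈ range (n + 1), |x i| ≤ α.maxRat →
        |(kahan α x n).1 - ∑ i ∈ range (n + 1), x i|
          ≤ α.unitRoundoff * |(kahan α x n).1|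
            + (2 * α.unitRoundoff + 6 * α.unitRoundoff ^ 2 + 12 * n * α.unitRoundoff ^ 2)
              * ∑ i ∈ range (n + 1), |x i| ∧
        |(kahan α x n).1 + (kahan α x n).2 - ∑ i ∈ range (n + 1), x i|
          ≤ (2 * α.unitRoundoff + 6 * α.unitRoundoff ^ 2 + 12 * n * α.unitRoundoff ^ 2)
              * ∑ i ∈ range (n + 1), |x i|

/-- R2 Kahan envelope: PROVED for every format (hypotheses as stated). -/
theorem R2_KahanEnvelope_holds (α : Format) : R2_KahanEnvelope α :=
  fun hα hu16 x n hnu hx hS =>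
    ⟨abs_kahan_sub_sum_le_of_sum_le hα hu16 x n hnu hx hS,
      abs_kahan_pair_sub_sum_le_of_sum_le hα hu16 x n hnu hx hS⟩

/-- The accumulator formats binary16, bfloat16, binary32 and `E4M3` satisfy the format hypotheses
of `R2_KahanEnvelope` (`emaxCode ≥ 2`, `u ≤ 1/16`). [folklore] -/
theorem R2_KahanEnvelope_accumulators :
    (2 ≤ Binary16.emaxCode ∧ Binary16.unitRoundoff ≤ 1 / 16) ∧
    (2 ≤ BFloat16.emaxCode ∧ BFloat16.unitRoundoff ≤ 1 / 16) ∧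
    (2 ≤ Binary32.emaxCode ∧ Binary32.unitRoundoff ≤ 1 / 16) ∧
    (2 ≤ E4M3.emaxCode ∧ E4M3.unitRoundoff ≤ 1 / 16) := by
  decide +kernel

/-- R2 (EXACT RANGE, the GEMM note's Lemma Z): inner products of `E2M1 × E2M1` data of length
`≤ 14` into binary16 and `≤ 116508` into binary32, `E3M2 × E3M2` of length `≤ 83` and
`E2M3 × E2M3` of length `≤ 4660` into binary32, and `E2M1 × E2M3` of length `≤ 2` into binary16 are
computed EXACTLY by every evaluation order under round-to-nearest-even and under truncation.
PROVED: `MiniFloat.E2M1_dot_Binary16_exact`, `E2M1_dot_Binary32_exact`, `E3M2_dot_Binary32_exact`,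
`E2M3_dot_Binary32_exact`, `E2M1_E2M3_dot_Binary16_exact` (ExactDot.lean, from the general
`eval_eq_exact_of_products`). -/
def R2_ExactDotLemmaZ : Prop :=
  (∀ t : SumTree, (∀ x ∈ t.leaves, ∃ (a b : MiniFloat E2M1), x = a.toRat * b.toRat) →
    t.leaves.length ≤ 14 →
      SumTree.eval (flα Binary16) t = SumTree.exact t ∧
      SumTree.eval (fun z => (roundTowardZero Binary16 z).toRat) t = SumTree.exact t) ∧
  (∀ t : SumTree, (∀ x ∈ t.leaves, ∃ (a b : MiniFloat E2M1), x = a.toRat * b.toRat) →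
    t.leaves.length ≤ 116508 →
      SumTree.eval (flα Binary32) t = SumTree.exact t ∧
      SumTree.eval (fun z => (roundTowardZero Binary32 z).toRat) t = SumTree.exact t) ∧
  (∀ t : SumTree, (∀ x ∈ t.leaves, ∃ (a b : MiniFloat E3M2), x = a.toRat * b.toRat) →
    t.leaves.length ≤ 83 →
      SumTree.eval (flα Binary32) t = SumTree.exact t ∧
      SumTree.eval (fun z => (roundTowardZero Binary32 z).toRat) t = SumTree.exact t) ∧
  (∀ t : SumTree, (∀ x ∈ t.leaves, ∃ (a b : MiniFloat E2M3), x = a.toRat * b.toRat) →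
    t.leaves.length ≤ 4660 →
      SumTree.eval (flα Binary32) t = SumTree.exact t ∧
      SumTree.eval (fun z => (roundTowardZero Binary32 z).toRat) t = SumTree.exact t) ∧
  (∀ t : SumTree, (∀ x ∈ t.leaves, ∃ (a : MiniFloat E2M1) (b : MiniFloat E2M3),
      x = a.toRat * b.toRat) → t.leaves.length ≤ 2 →
      SumTree.eval (flα Binary16) t = SumTree.exact t ∧
      SumTree.eval (fun z => (roundTowardZero Binary16 z).toRat) t = SumTree.exact t)

/-- R2 exact range (Lemma Z): PROVED. -/
theorem R2_ExactDotLemmaZ_holds : R2_ExactDotLemmaZ :=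
  ⟨E2M1_dot_Binary16_exact, E2M1_dot_Binary32_exact, E3M2_dot_Binary32_exact,
    E2M3_dot_Binary32_exact, E2M1_E2M3_dot_Binary16_exact⟩

/-- R2 (EFT UNDER TRUNCATION, same sign): for values `a, b ≥ 0` of any format the truncation
error `a + b - RZ(a + b)` is a value, and Fast2Sum with truncated operations returns it exactly when
`|b| ≤ |a|`; without the sign hypothesis this fails (`E5M2` witness). PROVED:
`MiniFloat.rz_addErr_representable_of_nonneg`, `MiniFloat.fast2Sum_rz_exact_of_nonneg`,
`MiniFloat.rz_addErr_not_always_representable` (DirectedEFT.lean). -/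
def R2_DirectedEFT (φ : Format) : Prop :=
  ∀ a b : MiniFloat φ, 0 ≤ a.toRat → 0 ≤ b.toRat →
    (∃ e : MiniFloat φ, e.toRat = a.toRat + b.toRat - (roundTowardZero φ (a.toRat + b.toRat)).toRat) ∧
    (|b.toRat| ≤ |a.toRat| →
      (roundTowardZero φ (b.toRat - (roundTowardZero φ
        ((roundTowardZero φ (a.toRat + b.toRat)).toRat - a.toRat)).toRat)).toRat
        = a.toRat + b.toRat - (roundTowardZero φ (a.toRat + b.toRat)).toRat)

/-- R2 truncated EFT: PROVED for every format. -/
theorem R2_DirectedEFT_holds (φ : Format) : R2_DirectedEFT φ :=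
  fun a b ha hb => ⟨rz_addErr_representable_of_nonneg a b ha hb,
    fun hba => (fast2Sum_rz_exact_of_nonneg a b ha hb hba).2⟩

-- The sign hypothesis of `R2_DirectedEFT` is necessary: `MiniFloat.rz_addErr_not_always_representable`
-- (DirectedEFT.lean, `E5M2` witness) — not restated here.

/-! ### R2 — the Lange–Rump constants (lean seat generation 4) -/

/-- R2 (LANGE–RUMP SHARP CONSTANT, ANY ORDER; [BoldoEtAl2023, Thm 4.5] = Lange–Rump, Math. Comp.
88, Prop 1): for a format `α` with `emaxCode ≥ 2`, every evaluation tree whose leaves are values of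
`α`, whose nodes stay in range and which performs `n - 1 ≤ ½u⁻¹` additions satisfies
`Σ|eᵢ| ≤ (n-1)u/(1+(n-1)u)·Σ|xᵢ|` and `|ŝ - s| ≤ (n-1)u/(1+(n-1)u)·Σ|xᵢ|`. PROVED:
`MiniFloat.absErr_flα_le_langeRump`, `MiniFloat.abs_eval_sub_exact_le_langeRump`
(AccumulateLangeRump.lean; sequential form `MiniFloat.abs_seqSum_sub_sum_le_langeRump`). -/
def R2_LangeRumpSharp (α : Format) : Prop :=
  2 ≤ α.emaxCode → ∀ t : SumTree, TreeInRange α t →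
    2 * ((t.leaves.length : ℚ) - 1) * α.unitRoundoff ≤ 1 →
      SumTree.absErr (flα α) t ≤ ((t.leaves.length : ℚ) - 1) * α.unitRoundoff
          / (1 + ((t.leaves.length : ℚ) - 1) * α.unitRoundoff) * SumTree.absSum t ∧
      |SumTree.eval (flα α) t - SumTree.exact t|
        ≤ ((t.leaves.length : ℚ) - 1) * α.unitRoundoff
          / (1 + ((t.leaves.length : ℚ) - 1) * α.unitRoundoff) * SumTree.absSum t

/-- R2 Lange–Rump sharp constant: PROVED for every format. -/
theorem R2_LangeRumpSharp_holds (α : Format) : R2_LangeRumpSharp α :=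
  fun hα t ht hk => ⟨absErr_flα_le_langeRump hα t ht hk, abs_eval_sub_exact_le_langeRump hα t ht hk⟩

/-- R2 (LANGE–RUMP HEIGHT BOUND; [BoldoEtAl2023, Thm 4.4] = Lange–Rump, Math. Comp. 88, Prop 3,
round-to-nearest case): for a format `α` with `emaxCode ≥ 2`, every evaluation tree with leaves in
`F_α`, nodes in range and height `h` with `(h+1)²u ≤ 1` satisfies `Σ|eᵢ| ≤ h·u·Σ|xᵢ|` and
`|ŝ - s| ≤ h·u·Σ|xᵢ|`. PROVED: `MiniFloat.absErr_flα_le_height_langeRump`,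
`MiniFloat.abs_eval_sub_exact_le_height_langeRump` (AccumulateHeight.lean). -/
def R2_LangeRumpHeight (α : Format) : Prop :=
  2 ≤ α.emaxCode → ∀ t : SumTree, TreeInRange α t →
    ((treeHeight t : ℚ) + 1) ^ 2 * α.unitRoundoff ≤ 1 →
      SumTree.absErr (flα α) t ≤ (treeHeight t : ℚ) * α.unitRoundoff * SumTree.absSum t ∧
      |SumTree.eval (flα α) t - SumTree.exact t| ≤ (treeHeight t : ℚ) * α.unitRoundoff * SumTree.absSum t

/-- R2 Lange–Rump height bound: PROVED for every format. -/
theorem R2_LangeRumpHeight_holds (α : Format) : R2_LangeRumpHeight α :=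
  fun hα t ht hh =>
    ⟨absErr_flα_le_height_langeRump hα t ht hh, abs_eval_sub_exact_le_height_langeRump hα t ht hh⟩

/-- The accumulator formats of the cell satisfy the format hypothesis of both rungs, with the
restrictions `n - 1 ≤ ½u⁻¹` reading `n ≤ 1025` (binary16), `129` (bfloat16), `2^23 + 1`
(binary32), `9` (E4M3), `5` (E5M2), and `(h+1)²u ≤ 1` reading `h ≤ 44` (binary16: `45² = 2025 ≤
2048`), `15` (bfloat16), `4095` (binary32), `3` (E4M3), `1` (E5M2). -/
theorem R2_LangeRump_accumulators :
    (2 ≤ Format.Binary16.emaxCode ∧ 2 * (1024 : ℚ) * Format.Binary16.unitRoundoff ≤ 1 ∧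
      ((44 : ℚ) + 1) ^ 2 * Format.Binary16.unitRoundoff ≤ 1) ∧
    (2 ≤ Format.BFloat16.emaxCode ∧ 2 * (128 : ℚ) * Format.BFloat16.unitRoundoff ≤ 1 ∧
      ((15 : ℚ) + 1) ^ 2 * Format.BFloat16.unitRoundoff ≤ 1) ∧
    (2 ≤ Format.Binary32.emaxCode ∧ 2 * (2 ^ 23 : ℚ) * Format.Binary32.unitRoundoff ≤ 1 ∧
      ((4095 : ℚ) + 1) ^ 2 * Format.Binary32.unitRoundoff ≤ 1) ∧
    (2 ≤ Format.E4M3.emaxCode ∧ 2 * (8 : ℚ) * Format.E4M3.unitRoundoff ≤ 1 ∧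
      ((3 : ℚ) + 1) ^ 2 * Format.E4M3.unitRoundoff ≤ 1) ∧
    (2 ≤ Format.E5M2.emaxCode ∧ 2 * (4 : ℚ) * Format.E5M2.unitRoundoff ≤ 1 ∧
      ((1 : ℚ) + 1) ^ 2 * Format.E5M2.unitRoundoff ≤ 1) := by
  simp only [Format.unitRoundoff_eq]
  refine ⟨⟨by decide, by norm_num [Format.Binary16], by norm_num [Format.Binary16]⟩,
    ⟨by decide, by norm_num [Format.BFloat16], by norm_num [Format.BFloat16]⟩,
    ⟨by decide, by norm_num [Format.Binary32], by norm_num [Format.Binary32]⟩,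
    ⟨by decide, by norm_num [Format.E4M3], by norm_num [Format.E4M3]⟩,
    ⟨by decide, by norm_num [Format.E5M2], by norm_num [Format.E5M2]⟩⟩

end Summit.Ventures.CertifiedArithmetic
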